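import Mathlib
import HarnessLib

/-!
# Chowla's congruence for the central factorial modulo a prime `p ≡ 1 (mod 4)`

Vendored fact [cite: Chowla1961, Theorem]; [cite: Mordell1961]; the sign normalisation follows
[cite: JacobsonWilliams2008, §9.2 eq. (9.7)] as fixed by the route planner's numerical read-back.

For a prime `p ≡ 1 (mod 4)` let `h` be the class number of `ℚ(√p)` (odd) and `ε_p = (t + u√p)/2` its
fundamental unit, of norm `−1`, i.e. `(t, u)` the least positive solution of `t² − p u² = −4`. Then
`((p−1)/2)! ≡ (−1)^{(h+1)/2} · t/2 (mod p)`, stated denominator-free as `p ∣ 2·((p−1)/2)! − (−1)^{(h+1)/2} t`.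
(Kiselev 1948; Chowla 1961; Mordell 1961 for the case analysis of `((p−1)/2)! ≡ ±1` when `p ≡ 3 (mod 4)`.)
Proof in print: Dirichlet's class number formula in the form `√p · ε_p^h = ∏_{n non-residue} (1 − ζ_p^n)`
reduced modulo `(1 − ζ_p)`.

Grounds `Summit.QuantumAdvantage.QuantumAdvantage.Theses.CentralFactorial.ChowlaSignLaw`
(stmt-QuantumAdvantage-10309): the body below is byte-identical to that route item (stated over Mathlib's
abstract number fields: any `K` of degree 2 and discriminant `p`), so the item is this fact with no
specialisation. The sign convention was read back numerically by the grounder for all 37 primes `p ≡ 1 (mod 4)`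
below 400 with independently computed `h` (cycles of reduced indefinite forms; `h = 3` at `p = 229, 257`) and
`t` (continued fraction of `(√p − 1)/2`), 0 mismatches (script attached to the item as evidence), and by the
planner for the 211 primes below 3000.
-/

namespace Literature.NumberTheory.QuadraticFields

/-- **Chowla's central-factorial congruence (Kiselev 1948 / Chowla 1961).** For `p ≡ 1 (mod 4)` prime,
`K` a quadratic number field of discriminant `p` with class number `h`, and `(t, u)` the least positive
solution of `t² + 4 = p u²`: `p ∣ 2·((p−1)/2)! − (−1)^{(h+1)/2}·t`.
[cite: Chowla1961, Theorem] [cite: Mordell1961] [cite: JacobsonWilliams2008, §9.2]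
Grounds `Summit.QuantumAdvantage.QuantumAdvantage.Theses.CentralFactorial.ChowlaSignLaw` (verbatim). -/
def chowla_central_factorial_congruence : Prop :=
  ∀ (p : ℕ) (K : Type) [Field K] [NumberField K] (t u : ℕ), p.Prime → p % 4 = 1 → Module.finrank ℚ K = 2 → NumberField.discr K = (p : ℤ) → t ^ 2 + 4 = p * u ^ 2 → 0 < u → (∀ t' u' : ℕ, t' ^ 2 + 4 = p * u' ^ 2 → 0 < u' → t ≤ t') → (p : ℤ) ∣ 2 * (Nat.factorial ((p - 1) / 2) : ℤ) - (-1) ^ ((NumberField.classNumber K + 1) / 2) * (t : ℤ)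

end Literature.NumberTheory.QuadraticFields
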